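import Literature.Geometry.Symplectic.SteinHandleProfileBounds
import HarnessLib

/-!
# Assembling Eliashberg's handle profile, V: the inequalities (3.2) of Forstnerič–Kozak

Topic `Literature/Geometry/Symplectic`; proofs file of the fact seat of
`Literature.Geometry.Symplectic.Gompf1998_thm13_twoHandles` (**E2**, `SteinTwoHandles.lean`),
sequel of `SteinHandleProfileBounds.lean`.  **Main result of the profile construction**
(`shape_ineq_eventually`): for the parameters `(λ, ε)` subject to the smallness hypotheses
`Shape` (all satisfied for every `λ > 1` once `ε` is small), and for all sufficiently small
window widths `ω > 0`, the `C^∞` profile `f = ff ω β⋆ r₀⋆` with slope `f' = fp ω β⋆` and second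
derivative `f'' = φ ω β⋆` satisfies the two inequalities (3.2) of Forstnerič–Kozak,
`f (f'' + f'³/t) > 1` and `f f'/t > 1`, **at every `t > σ`** — i.e. (Cor. 2.2) the domain
`{x + iy ∈ ℂ² : |y| > f(|x|)}` is strongly pseudoconvex along `{|y| = f(|x|)}`, which together
with `f = g` for `t ≥ ε(1 + ω)` (`ff_eq_quadric`), `f = startFn` near `σ` (`ff_eq_startFn`) and
`f' > 0` is Forstnerič–Kozak's Prop. 3.1 (= Eliashberg 1990, Lemma 3.4.3) for this profile.
The proof goes zone by zone: the exact start (`start_shape_ineq`), the three windows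
(`junction_shape_ineq` at `(t₂, 2)`, `(η, c₁)` with `f ≥ 1/2`, and at `(ε, g'(ε))` with
`f ≥ m₁`), the descending region (`region2_shape_ineq`), the convex region
(`region1_shape_ineq` with `A' = A - |β⋆|`) and the quadric tail (`quadric_shape_ineq`).

Finally (§ "small `ε`"), **for every `λ > 1` the hypotheses `Shape` hold for all sufficiently
small `ε > 0`** (`shape_eventually`) — Forstnerič–Kozak: *"For every sufficiently small `ε > 0`
there exists a number `σ = σ(ε) ∈ (0, ε)` and a … function `f = f_ε`"* — by elementary limits as
`ε → 0⁺`: `g(ε) → 1`, `g''(ε) → λ > A = (1 + λ)/2`, `c₀/ε → (λ - 1)/4 > 0`, `c₁ → 0`,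
`η = O(ε³)`, `m₁ → 1`, `g'(ε)/ε → λ`.

Everything is **proved**; no definition besides the hypothesis structure `Shape`, no named fact.

## References

* F. Forstnerič, J. Kozak, *Strongly pseudoconvex handlebodies*, J. Korean Math. Soc. 40
  (2003), 727–745 (arXiv:math/0305237), Prop. 3.1, Cor. 2.2, (3.2). [ForstnericKozak2003]
* Ya. Eliashberg, *Topological characterization of Stein manifolds of dimension > 2*,
  Internat. J. Math. 1 (1990), 29–46, Lemma 3.4.3. [Eliashberg1990Stein]
-/

noncomputable section

open Set Filter MeasureTheory intervalIntegral
open scoped Topology ContDiff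

namespace Literature.Geometry.Symplectic

namespace HParam

variable {P : HParam}

/-- The smallness hypotheses on `(λ, ε)` for the inequalities (3.2): those of `Small`, and the
junction conditions at `t = ε` with the lower bound `m₁` of the profile there
(`m₁ A > 1`, `m₁ (g''(ε) + g'(ε)³/ε) > 1`, `m₁ g'(ε)/ε > 1`), and `A η ≤ c₁/2`. [folklore] -/
structure Shape : Prop extends P.Small where
  m₁_pos : 0 < P.m₁
  one_lt_m₁A : 1 < P.m₁ * P.A
  junction_ε₁ : 1 < P.m₁ * (P.gppε + P.gpε ^ 3 / P.ε)
  junction_ε₂ : 1 < P.m₁ * P.gpε / P.ε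
  Aη_le : P.A * P.η ≤ P.c₁ / 2

/-- `σ < 1/2` (indeed `σ < ε/8 ≤ 1/160`). [folklore] -/
theorem Small.σ_lt_half (h : P.Small) : P.σ < 1 / 2 := by
  have := h.toPos.σ_lt_ε; have := h.ε_le; linarith

/-- **The junction conditions at `t₂` with `f ≥ 1/2`.** [folklore] -/
theorem Small.junction_t₂ (h : P.Small) :
    1 < 1 / 2 * (P.Q₀ P.t₂ + 2 ^ 3 / P.t₂) ∧ 1 < 1 / 2 * (P.Q₂ P.t₂ + 2 ^ 3 / P.t₂) ∧
      1 < 1 / 2 * 2 / P.t₂ := by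
  have hp := h.toPos
  have hσ := hp.σ_pos
  have hσ2 := h.σ_lt_half
  rw [Q₀_t₂ hp, Q₂_t₂ hp, t₂_eq]
  refine ⟨?_, ?_, ?_⟩
  · rw [show 1 / 2 * (-(4 / (3 * P.σ)) + 2 ^ 3 / (2 * P.σ)) = 4 / (3 * P.σ) by field_simp; ring,
      lt_div_iff₀ (by positivity)]; linarith
  · rw [show 1 / 2 * (-(2 / P.σ) + 2 ^ 3 / (2 * P.σ)) = 1 / P.σ by field_simp; ring,
      lt_div_iff₀ hσ]; linarith
  · rw [show 1 / 2 * 2 / (2 * P.σ) = 1 / (2 * P.σ) by field_simp, lt_div_iff₀ (by positivity)]; linarith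

/-- **The junction conditions at `η` with `f ≥ 1/2`.** [folklore] -/
theorem Small.junction_η (h : P.Small) :
    1 < 1 / 2 * (P.Q₂ P.η + P.c₁ ^ 3 / P.η) ∧ 1 < 1 / 2 * (P.Q₁ P.η + P.c₁ ^ 3 / P.η) ∧
      1 < 1 / 2 * P.c₁ / P.η := by
  have hp := h.toPos
  have hη := hp.η_pos
  have hc := hp.c₁_pos
  have hc1 := hp.c₁_le
  have hA := hp.one_lt_A
  have hηle := h.η_le
  -- `c₁³/η ≥ 40`
  have h40 : 40 ≤ P.c₁ ^ 3 / P.η := by rw [le_div_iff₀ hη]; linarith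
  have hcη : 40 ≤ P.c₁ / P.η := by
    rw [le_div_iff₀ hη]
    have : P.c₁ ^ 3 ≤ P.c₁ := by
      calc P.c₁ ^ 3 = P.c₁ * (P.c₁ * P.c₁) := by ring
        _ ≤ P.c₁ * (1 * 1) := by gcongr
        _ = P.c₁ := by ring
    linarith
  rw [Q₂_η hp, Q₁_η]
  refine ⟨?_, ?_, ?_⟩
  · have : 1 / 2 * (-(P.c₁ ^ 3 / (2 * P.η)) + P.c₁ ^ 3 / P.η) = (P.c₁ ^ 3 / P.η) / 4 := by
      field_simp; ring
    rw [this]; linarith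
  · nlinarith
  · rw [mul_div_assoc]; linarith

/-! ### The main theorem -/

set_option maxHeartbeats 1600000 in
/-- **The inequalities (3.2) of Forstnerič–Kozak for the assembled profile, at every `t > σ`,
for all sufficiently small `ω > 0`** (with `β = β⋆ ω`, `r₀ = r₀⋆ ω`):
`f (f'' + f'³/t) > 1` and `f f'/t > 1` where `f = ff`, `f' = fp`, `f'' = φ`.
[cite: ForstnericKozak2003, Prop. 3.1] -/
theorem shape_ineq_eventually (h : P.Shape) :
    ∀ᶠ om in 𝓝[>] 0, 0 < om ∧ om ≤ 1 / 8 ∧ ∀ t, P.σ < t →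
      1 < P.ff om (P.βs om) (P.r₀s om) t * (P.φ om (P.βs om) t + P.fp om (P.βs om) t ^ 3 / t) ∧
        1 < P.ff om (P.βs om) (P.r₀s om) t * P.fp om (P.βs om) t / t := by
  have hs := h.toSmall
  have hp := hs.toPos
  have hσ := hp.σ_pos
  have hη := hp.η_pos
  have hε := hp.ε_pos
  have hc₁ := hp.c₁_pos
  have hc₁1 := hp.c₁_le
  have hA1 := hp.one_lt_A
  have ht₂p := hp.t₂_pos
  have ht₂ := t₂_eq P
  have hm₁ := h.m₁_pos
  obtain ⟨hgp, hgpl⟩ := hs.gpε_bounds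
  -- junction lemmas (independent of `ω`)
  obtain ⟨hcP, hcQ0, hcQ2t, -⟩ := continuousAt_t₂ hp
  obtain ⟨-, hcQ2η, hcQ1η⟩ := continuousAt_η hp
  obtain ⟨hcQ1ε, hcQgε, -, -⟩ := continuousAt_ε hp
  obtain ⟨j1a, j1b, j1c⟩ := hs.junction_t₂
  obtain ⟨j2a, j2b, j2c⟩ := hs.junction_η
  obtain ⟨δa, hδa, Ja⟩ := junction_shape_ineq ht₂p (by norm_num : (0:ℝ) < 1 / 2) hcQ0 hcQ2t j1a j1b j1c
  obtain ⟨δb, hδb, Jb⟩ := junction_shape_ineq hη (by norm_num : (0:ℝ) < 1 / 2) hcQ2η hcQ1η j2a j2b j2c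
  have j3a : 1 < P.m₁ * (P.Q₁ P.ε + P.gpε ^ 3 / P.ε) := by rw [Q₁_ε hp]; exact h.junction_ε₁
  have j3b : 1 < P.m₁ * (P.Qg P.ε + P.gpε ^ 3 / P.ε) := by rw [Qg_ε]; exact h.junction_ε₁
  obtain ⟨δc, hδc, Jc⟩ := junction_shape_ineq hε hm₁ hcQ1ε hcQgε j3a j3b h.junction_ε₂
  -- eventual facts
  have e0 := fp_pos_le_eventually hs
  have e1 := ff_ge_m₁_eventually hs
  have ew1 := fp_win₁_tendsto hp (0 : ℝ) hδa
  have ew2 := fp_win₂_tendsto hp (0 : ℝ) hδb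
  have ew3 := fp_win₃_tendsto hp hδc
  have e4 : ∀ᶠ om in 𝓝[>] 0, |P.δ₁ om 0| < P.c₁ / 10 := by
    have := (Metric.tendsto_nhds.1 (δ₁_tendsto hp 0)) (P.c₁ / 10) (by positivity)
    filter_upwards [this] with om hom; rwa [Real.dist_eq, sub_zero] at hom
  set β₀ := min (1 / 2) ((P.m₁ * P.A - 1) / (2 * P.m₁)) with hβ₀
  have hβ₀pos : 0 < β₀ := by
    rw [hβ₀, lt_min_iff]; exact ⟨by norm_num, div_pos (by linarith [h.one_lt_m₁A]) (by positivity)⟩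
  have e5 : ∀ᶠ om in 𝓝[>] 0, |P.βs om| < β₀ := by
    have := (Metric.tendsto_nhds.1 (βs_tendsto hp)) β₀ hβ₀pos
    filter_upwards [this] with om hom; rwa [Real.dist_eq, sub_zero] at hom
  have e6 : ∀ᶠ om in 𝓝[>] 0, |P.fp om 0 (P.η * (1 + om)) - P.c₁| < P.c₁ / 10 := by
    filter_upwards [fp_win₂_tendsto hp 0 (by positivity : 0 < P.c₁ / 10), self_mem_nhdsWithin] with om hom hom0
    have hom0' : 0 < om := hom0
    exact hom _ ⟨by nlinarith, le_rfl⟩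
  have e7 := eventually_pos_lt (c := min (δa / P.t₂) (min (δb / P.η) (δc / P.ε))) (by positivity)
  filter_upwards [e0, e1, ew1, ew2, ew3, e4, e5, e6, e7] with om h0 h1 w1 w2 w3 h4 h5 h6 h7
  obtain ⟨hom, hom8, hb⟩ := h0
  obtain ⟨-, hlt⟩ := h7
  simp only [lt_min_iff] at hlt
  obtain ⟨hδa', hδb', hδc'⟩ := hlt
  refine ⟨hom, hom8, fun t hσt => ?_⟩
  obtain ⟨s1, s2, s3⟩ := hp.sizes hom.le hom8
  have ht0 : 0 < t := lt_trans hσ hσt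
  have hη2 : P.η * (1 - om) ≤ P.η * (1 + om) := by nlinarith
  have hε2 : P.ε * (1 - om) ≤ P.ε * (1 + om) := by nlinarith
  -- abbreviations
  set f := P.ff om (P.βs om) (P.r₀s om) with hf
  set p := P.fp om (P.βs om) with hpdef
  set T := P.ε * (1 + om) with hT
  have hσT : P.σ < T := by rw [hT]; nlinarith [hp.σ_lt_ε]
  -- `β`-independence left of `3ε/10`
  have hind : ∀ x, P.σ < x → x ≤ 3 * P.ε / 10 → p x = P.fp om 0 x := fun x hx hx' =>
    fp_indep_β hp hom hom8 _ hx hx'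
  -- lower bounds for `f`
  have hr₀ : 1 / 2 ≤ P.r₀s om := half_le_r₀s hs hom hom8 hb
  have hfhalf : ∀ x, P.σ < x → x ≤ T → 1 / 2 ≤ f x := fun x hx hxT => by
    have := ff_ge_r₀ hp hom hom8 (fun y hy hyT => (hb y hy hyT).1) hx hxT
    rw [hf]; linarith
  have hβ : |P.βs om| < 1 / 2 ∧ |P.βs om| < (P.m₁ * P.A - 1) / (2 * P.m₁) := by
    rw [hβ₀, lt_min_iff] at h5; exact h5
  -- zone analysis
  by_cases z0 : t ≤ P.t₂ * (1 - om)
  · -- exact start zone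
    have h2σ : t ≤ 2 * P.σ := by rw [ht₂] at z0; nlinarith
    have hrσ : P.σ < P.r₀s om := by linarith [hs.σ_lt_half]
    have key := start_shape_ineq (L₀ := 6) hσ (by norm_num) hrσ hσt h2σ
    rw [hf, hpdef, ff_eq_startFn hp hom hom8 _ _ hσt z0, fp_eq_P₀ hp hom hom8 _ hσt z0,
      φ_eq_Q₀ hp hom _ z0]
    exact key
  rw [not_le] at z0
  by_cases z1 : t ≤ P.t₂ * (1 + om)
  · -- first window
    have htj : |t - P.t₂| < δa := by
      have e1 : P.t₂ * (1 - om) = P.t₂ - om * P.t₂ := by ring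
      have e2 : P.t₂ * (1 + om) = P.t₂ + om * P.t₂ := by ring
      have : |t - P.t₂| ≤ om * P.t₂ := by rw [abs_le]; constructor <;> linarith [z0.le]
      exact lt_of_le_of_lt this (by rwa [lt_div_iff₀ ht₂p] at hδa')
    have hpj : |p t - 2| < δa := by
      rw [hind t hσt (by linarith [show P.η * (1 - om) ≤ 3 * P.ε / 10 by nlinarith])]
      exact w1 t ⟨z0.le, z1⟩
    have hq : P.φ om (P.βs om) t ∈ uIcc (P.Q₀ t) (P.Q₂ t) := by
      rw [φ_win₁ hp hom hom8 _ z1]; exact glue_mem_uIcc (window_nonneg t) (window_le_one t)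
    exact Ja t (p t) _ (f t) htj hpj hq (hfhalf t hσt (by rw [hT]; linarith))
  rw [not_le] at z1
  by_cases z2 : t ≤ P.η * (1 - om)
  · -- descending region
    have hdesc := fp_desc hp hom hom8 (P.βs om) z1.le z2
    have hδ : P.δ₁ om (P.βs om) = P.δ₁ om 0 := by
      rw [δ₁, δ₁, fp_indep_β hp hom hom8 _ (by rw [ht₂]; nlinarith) (s1.trans (by linarith))]
    rw [hδ] at hdesc
    have htη : t ≤ P.η := z2.trans (by nlinarith)
    obtain ⟨hlo, -⟩ := descSlope_mem hp (by nlinarith : P.t₂ ≤ t) htη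
    rw [abs_lt] at h4
    have hq : P.φ om (P.βs om) t = -(descSlope P.Cc P.η t) ^ 3 / (2 * t) := by
      rw [φ_eq_Q₂ hp hom _ z1.le z2, Q₂]
    have key := region2_shape_ineq (f := f t) (p := p t) (P := descSlope P.Cc P.η t)
      (q := P.φ om (P.βs om) t) (t := t) (m := 1 / 2) (c := P.c₁) (η := P.η)
      (by norm_num) (hfhalf t hσt (by nlinarith [hp.η_lt])) ht0 htη hc₁ hc₁1 hlo
      (by rw [hpdef, hdesc]; linarith) hq (by have := hs.η_le; nlinarith)
    exact key
  rw [not_le] at z2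
  by_cases z3 : t ≤ P.η * (1 + om)
  · -- second window
    have htj : |t - P.η| < δb := by
      have e1 : P.η * (1 - om) = P.η - om * P.η := by ring
      have e2 : P.η * (1 + om) = P.η + om * P.η := by ring
      have : |t - P.η| ≤ om * P.η := by rw [abs_le]; constructor <;> linarith [z2.le]
      exact lt_of_le_of_lt this (by rwa [lt_div_iff₀ hη] at hδb')
    have hpj : |p t - P.c₁| < δb := by
      rw [hind t hσt (z3.trans s2)]; exact w2 t ⟨z2.le, z3⟩
    have hq : P.φ om (P.βs om) t ∈ uIcc (P.Q₂ t) (P.Q₁ t) := by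
      rw [φ_win₂ hp hom hom8 _ z2.le z3]; exact glue_mem_uIcc (window_nonneg t) (window_le_one t)
    exact Jb t (p t) _ (f t) htj hpj hq (hfhalf t hσt (by rw [hT]; linarith))
  rw [not_le] at z3
  by_cases z4 : t ≤ P.ε * (1 - om)
  · -- convex region
    have hfm' : P.m₁ ≤ f t := h1 t z3.le (z4.trans (by rw [hT]; nlinarith))
    set a := P.η * (1 + om) with ha
    have hσa : P.σ < a := by rw [ha]; rw [ht₂] at s1; nlinarith
    have hηa : P.η ≤ a := by rw [ha]; nlinarith
    have hconv := fp_convex_eq hp hom hom8 (P.βs om) z3.le z4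
    have hPsub := hs.P₁_sub_ge hηa z3.le
    have hta : 0 ≤ t - a := by linarith
    have hψI : |P.βs om * ∫ x in a..t, P.ψ x| ≤ |P.βs om| * (t - a) := by
      rw [abs_mul]
      have h8 : |∫ x in a..t, P.ψ x| ≤ 1 * |t - a| :=
        abs_integral_le_of_abs_le fun x _ => by rw [abs_of_nonneg (ψ_nonneg x)]; exact ψ_le_one x
      have hta' : |t - a| = t - a := abs_of_nonneg hta
      rw [hta', one_mul] at h8
      exact mul_le_mul_of_nonneg_left h8 (abs_nonneg _)
    rw [abs_le] at hψI
    -- `p a ≥ 0.9 c₁ ≥ A a`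
    have hpa : 9 / 10 * P.c₁ < p a := by
      have := h6; rw [abs_lt] at this; rw [hind a hσa s2]; linarith
    have hAa : P.A * a ≤ 9 / 10 * P.c₁ := by
      rw [ha]; have := h.Aη_le; nlinarith [hA1.le]
    set A' := P.A - |P.βs om| with hA'
    have hA'0 : 0 < A' := by rw [hA']; linarith [hβ.1]
    -- `q ≥ A'`
    have hq : A' ≤ P.φ om (P.βs om) t := by
      rw [φ_eq_Q₁_add hp hom _ z3.le z4]
      have h9 : P.A ≤ P.Q₁ t := hs.A_le_Q₁ (hηa.trans z3.le)
      have h10 : |P.βs om * P.ψ t| ≤ |P.βs om| := by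
        rw [abs_mul]; exact mul_le_of_le_one_right (abs_nonneg _) (by rw [abs_of_nonneg (ψ_nonneg t)]; exact ψ_le_one t)
      rw [abs_le] at h10
      rw [hA']; linarith
    -- `p ≥ A' t`
    have hpt : A' * t ≤ p t := by
      have hpa' : 9 / 10 * P.c₁ < P.fp om (P.βs om) a := hpa
      rw [hpdef, hconv, hA']
      have e1 : (P.A - |P.βs om|) * t = P.A * a + P.A * (t - a) - |P.βs om| * (t - a) - |P.βs om| * a := by
        ring
      rw [e1]
      have h11 : 0 ≤ |P.βs om| * a := mul_nonneg (abs_nonneg _) (by linarith)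
      linarith [hψI.1]
    -- `f A' > 1`
    have hfA : 1 < f t * A' := by
      have h12 : 1 < P.m₁ * A' := by
        rw [hA']
        have h13 : P.m₁ * |P.βs om| < (P.m₁ * P.A - 1) / 2 := by
          have := hβ.2
          calc P.m₁ * |P.βs om| < P.m₁ * ((P.m₁ * P.A - 1) / (2 * P.m₁)) := mul_lt_mul_of_pos_left this hm₁
            _ = (P.m₁ * P.A - 1) / 2 := by field_simp
        have e2 : P.m₁ * (P.A - |P.βs om|) = P.m₁ * P.A - P.m₁ * |P.βs om| := by ring
        rw [e2]
        linarith [h.one_lt_m₁A]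
      calc (1 : ℝ) < P.m₁ * A' := h12
        _ ≤ f t * A' := mul_le_mul_of_nonneg_right hfm' hA'0.le
    exact region1_shape_ineq hA'0 hfA hq hpt ht0
  rw [not_le] at z4
  by_cases z5 : t ≤ T
  · -- third window
    have hfm' : P.m₁ ≤ f t := h1 t z3.le z5
    have htj : |t - P.ε| < δc := by
      have e1 : P.ε * (1 - om) = P.ε - om * P.ε := by ring
      have e2 : T = P.ε + om * P.ε := by rw [hT]; ring
      have : |t - P.ε| ≤ om * P.ε := by rw [abs_le]; constructor <;> linarith [z4.le, z5]
      exact lt_of_le_of_lt this (by rwa [lt_div_iff₀ hε] at hδc')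
    have hpj : |p t - P.gpε| < δc := w3 t ⟨z4.le, z5⟩
    have hq : P.φ om (P.βs om) t ∈ uIcc (P.Q₁ t) (P.Qg t) := by
      rw [φ_win₃ hp hom hom8 _ z4.le]; exact glue_mem_uIcc (window_nonneg t) (window_le_one t)
    exact Jc t (p t) _ (f t) htj hpj hq hfm'
  · -- quadric tail
    rw [not_le] at z5
    have hl := hp.one_lt_l
    rw [hf, hpdef, ff_eq_quadric hp hom hom8 z5.le, fp_eq_quadric_deriv hp hom hom8 z5.le,
      φ_eq_Qg hp hom _ z5.le, Qg]
    exact quadric_shape_ineq hl ht0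

/-! ## The smallness hypotheses hold for small `ε` -/

section SmallEps

variable {l : ℝ}

/-! ### Continuity at `ε = 0` of the ingredients -/

/-- `ε ↦ g(ε) = √(λε² + 1)` is continuous, `g(0) = 1`. [folklore] -/
theorem continuous_quadric_param (l : ℝ) : Continuous (quadric l) := by
  show Continuous fun t => Real.sqrt (l * t ^ 2 + 1); fun_prop

/-- `g(0) = 1`. [folklore] -/
theorem quadric_zero (l : ℝ) : quadric l 0 = 1 := by simp [quadric]

/-- The function `H(ε) = λ/g(ε) - (A + λ/g(ε)³)/2` with `c₀ = ε H(ε)`; `H(0) = (λ - 1)/4`. [folklore] -/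
theorem continuous_H (hl : 0 ≤ l) :
    Continuous fun ε => l / quadric l ε - ((1 + l) / 2 + l / quadric l ε ^ 3) / 2 := by
  have hg : ∀ ε, quadric l ε ≠ 0 := fun ε => (quadric_pos hl ε).ne'
  have hc := continuous_quadric_param l
  exact (continuous_const.div hc hg).sub
    ((continuous_const.add (continuous_const.div (hc.pow 3) fun ε => pow_ne_zero 3 (hg ε))).div_const 2)

/-- Unfolding of the constants of `⟨λ, ε⟩`. [folklore] -/
theorem c₀_mk (l ε : ℝ) :
    (HParam.mk l ε).c₀ = ε * (l / quadric l ε - ((1 + l) / 2 + l / quadric l ε ^ 3) / 2) := by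
  simp only [c₀, gpε, gε, A, gppε]; ring

/-- Unfolding of `c₁ = c₀ + η (A + g'')/2`. [folklore] -/
theorem c₁_mk (l ε : ℝ) :
    (HParam.mk l ε).c₁ = (HParam.mk l ε).c₀ + (HParam.mk l ε).η * ((1 + l) / 2 + l / quadric l ε ^ 3) / 2 := by
  simp only [c₁, c₀, gpε, gε, A, gppε]; ring

/-- An eventual strict inequality at `0⁺` from continuity at `0`. [folklore] -/
theorem eventually_gt_of_continuousAt {F : ℝ → ℝ} {c : ℝ} (hF : ContinuousAt F 0) (h0 : c < F 0) :
    ∀ᶠ ε in 𝓝[>] (0 : ℝ), c < F ε :=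
  (hF.eventually (Ioi_mem_nhds h0)).filter_mono nhdsWithin_le_nhds

/-- An eventual strict inequality at `0⁺` from continuity at `0` (other direction). [folklore] -/
theorem eventually_lt_of_continuousAt {F : ℝ → ℝ} {c : ℝ} (hF : ContinuousAt F 0) (h0 : F 0 < c) :
    ∀ᶠ ε in 𝓝[>] (0 : ℝ), F ε < c :=
  (hF.eventually (Iio_mem_nhds h0)).filter_mono nhdsWithin_le_nhds

/-! ### The smallness hypotheses hold eventually -/

set_option maxHeartbeats 800000 in
/-- **For every `λ > 1`, the hypotheses `Shape` (hence `Small`, `Pos`) hold for all sufficiently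
small `ε > 0`.** [cite: ForstnericKozak2003, Prop. 3.1] -/
theorem shape_eventually (hl : 1 < l) : ∀ᶠ ε in 𝓝[>] (0 : ℝ), (HParam.mk l ε).Shape := by
  have hl0 : 0 ≤ l := by linarith
  have hlpos : 0 < l := by linarith
  -- the continuous ingredients
  set g : ℝ → ℝ := quadric l with hgdef
  set H : ℝ → ℝ := fun ε => l / quadric l ε - ((1 + l) / 2 + l / quadric l ε ^ 3) / 2 with hHdef
  have hgc : Continuous g := continuous_quadric_param l
  have hg0 : g 0 = 1 := quadric_zero l
  have hgne : ∀ ε, g ε ≠ 0 := fun ε => (quadric_pos hl0 ε).ne'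
  have hHc : Continuous H := continuous_H hl0
  have hH0 : H 0 = (l - 1) / 4 := by simp only [hHdef, quadric_zero]; ring
  have hH0pos : 0 < H 0 := by rw [hH0]; linarith
  -- `c₀`, `η`, `c₁`, `m₁` as functions of `ε`
  set c₀f : ℝ → ℝ := fun ε => ε * H ε with hc₀f
  set ηf : ℝ → ℝ := fun ε => c₀f ε ^ 3 / 40 with hηf
  set Gf : ℝ → ℝ := fun ε => (1 + l) / 2 + l / g ε ^ 3 with hGf   -- `A + g''(ε)`
  set c₁f : ℝ → ℝ := fun ε => c₀f ε + ηf ε * Gf ε / 2 with hc₁f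
  set m₁f : ℝ → ℝ := fun ε => g ε - (c₁f ε * ε + (1 + l) / 2 * ε ^ 2 / 2 + l / g ε ^ 3 * ε ^ 2 / 6 + ε ^ 2)
    with hm₁f
  have hGc : Continuous Gf := continuous_const.add (continuous_const.div (hgc.pow 3) fun ε => pow_ne_zero 3 (hgne ε))
  have hc₀c : Continuous c₀f := continuous_id.mul hHc
  have hηc : Continuous ηf := (hc₀c.pow 3).div_const 40
  have hc₁c : Continuous c₁f := hc₀c.add ((hηc.mul hGc).div_const 2)
  have hm₁c : Continuous m₁f := by
    refine hgc.sub ((((hc₁c.mul continuous_id).add ?_).add ?_).add (continuous_id.pow 2))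
    · exact (continuous_const.mul (continuous_id.pow 2)).div_const 2
    · exact ((continuous_const.div (hgc.pow 3) fun ε => pow_ne_zero 3 (hgne ε)).mul (continuous_id.pow 2)).div_const 6
  have hc₀0 : c₀f 0 = 0 := by simp [hc₀f]
  have hη0 : ηf 0 = 0 := by simp [hηf, hc₀0]
  have hc₁0 : c₁f 0 = 0 := by simp [hc₁f, hc₀0, hη0]
  have hG0 : Gf 0 = (1 + l) / 2 + l := by simp [hGf, hg0]
  have hm₁0 : m₁f 0 = 1 := by simp [hm₁f, hg0, hc₁0]
  -- identification with the constants of `⟨l, ε⟩`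
  have ic₀ : ∀ ε, (HParam.mk l ε).c₀ = c₀f ε := fun ε => by rw [c₀_mk]
  have iη : ∀ ε, (HParam.mk l ε).η = ηf ε := fun ε => by simp only [η, ic₀]; rfl
  have ic₁ : ∀ ε, (HParam.mk l ε).c₁ = c₁f ε := fun ε => by rw [c₁_mk, ic₀, iη]
  have iA : ∀ ε, (HParam.mk l ε).A = (1 + l) / 2 := fun ε => rfl
  have igpp : ∀ ε, (HParam.mk l ε).gppε = l / g ε ^ 3 := fun ε => rfl
  have igp : ∀ ε, (HParam.mk l ε).gpε = l * ε / g ε := fun ε => rfl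
  have im₁ : ∀ ε, (HParam.mk l ε).m₁ = m₁f ε := fun ε => by
    simp only [m₁, ic₁, iA, igpp]; rfl
  -- the eventual inequalities
  have E1 : ∀ᶠ ε in 𝓝[>] (0:ℝ), 0 < ε := self_mem_nhdsWithin
  have E2 : ∀ᶠ ε in 𝓝[>] (0:ℝ), ε < 1 / 20 := eventually_lt_of_continuousAt continuousAt_id (by norm_num)
  have E2' : ∀ᶠ ε in 𝓝[>] (0:ℝ), ε < 1 / l := eventually_lt_of_continuousAt continuousAt_id (by positivity)
  have E3 : ∀ᶠ ε in 𝓝[>] (0:ℝ), 0 < H ε := eventually_gt_of_continuousAt hHc.continuousAt hH0pos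
  have E4 : ∀ᶠ ε in 𝓝[>] (0:ℝ), H ε < l := eventually_lt_of_continuousAt hHc.continuousAt (by rw [hH0]; linarith)
  have E5 : ∀ᶠ ε in 𝓝[>] (0:ℝ), ε ^ 2 * H ε ^ 3 < 10 := by
    have hc : Continuous fun ε => ε ^ 2 * H ε ^ 3 := (continuous_id.pow 2).mul (hHc.pow 3)
    exact eventually_lt_of_continuousAt hc.continuousAt (by simp)
  have E6 : ∀ᶠ ε in 𝓝[>] (0:ℝ), c₁f ε < 1 := eventually_lt_of_continuousAt hc₁c.continuousAt (by rw [hc₁0]; norm_num)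
  have E7 : ∀ᶠ ε in 𝓝[>] (0:ℝ), (1 + l) / 2 < l / g ε ^ 3 := by
    have hc : Continuous fun ε => l / g ε ^ 3 := continuous_const.div (hgc.pow 3) fun ε => pow_ne_zero 3 (hgne ε)
    exact eventually_gt_of_continuousAt hc.continuousAt (by simp [hg0]; linarith)
  have E8 : ∀ᶠ ε in 𝓝[>] (0:ℝ), 0 < m₁f ε := eventually_gt_of_continuousAt hm₁c.continuousAt (by rw [hm₁0]; norm_num)
  have E9 : ∀ᶠ ε in 𝓝[>] (0:ℝ), 1 < m₁f ε * ((1 + l) / 2) :=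
    eventually_gt_of_continuousAt (hm₁c.mul continuous_const).continuousAt (by rw [hm₁0]; linarith)
  have E10 : ∀ᶠ ε in 𝓝[>] (0:ℝ), 1 < m₁f ε * (l / g ε ^ 3 + ε ^ 2 * (l / g ε) ^ 3) := by
    have hc : Continuous fun ε => m₁f ε * (l / g ε ^ 3 + ε ^ 2 * (l / g ε) ^ 3) :=
      hm₁c.mul ((continuous_const.div (hgc.pow 3) fun ε => pow_ne_zero 3 (hgne ε)).add
        ((continuous_id.pow 2).mul ((continuous_const.div hgc hgne).pow 3)))
    exact eventually_gt_of_continuousAt hc.continuousAt (by simp [hm₁0, hg0]; linarith)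
  have E11 : ∀ᶠ ε in 𝓝[>] (0:ℝ), 1 < m₁f ε * (l / g ε) :=
    eventually_gt_of_continuousAt (hm₁c.mul (continuous_const.div hgc hgne)).continuousAt
      (by simp [hm₁0, hg0]; linarith)
  have E12 : ∀ᶠ ε in 𝓝[>] (0:ℝ), (1 + l) / 2 * (ε ^ 2 * H ε ^ 2) < 20 := by
    have hc : Continuous fun ε => (1 + l) / 2 * (ε ^ 2 * H ε ^ 2) :=
      continuous_const.mul ((continuous_id.pow 2).mul (hHc.pow 2))
    exact eventually_lt_of_continuousAt hc.continuousAt (by simp)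
  filter_upwards [E1, E2, E2', E3, E4, E5, E6, E7, E8, E9, E10, E11, E12] with
    ε h1 h2 h2' h3 h4 h5 h6 h7 h8 h9 h10 h11 h12
  -- basic quantities at this `ε`
  have hc₀ : 0 < c₀f ε := mul_pos h1 h3
  have hc₀' : c₀f ε = ε * H ε := rfl
  have hη' : ηf ε = c₀f ε ^ 3 / 40 := rfl
  have hηpos : 0 < ηf ε := by rw [hη']; positivity
  have hG : Gf ε = (1 + l) / 2 + l / g ε ^ 3 := rfl
  have hGpos : 0 < Gf ε := by rw [hG]; have := quadric_pos hl0 ε; positivity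
  have hc₁' : c₁f ε = c₀f ε + ηf ε * Gf ε / 2 := rfl
  have hc₀c₁ : c₀f ε ≤ c₁f ε := by rw [hc₁']; nlinarith
  have hlε : l * ε < 1 := by rwa [lt_div_iff₀ hlpos, mul_comm] at h2'
  -- `η < ε/4`: `η = ε³ H³/40 < ε/4`
  have hηε : ηf ε < ε / 4 := by
    rw [hη', hc₀']
    have : (ε * H ε) ^ 3 / 40 = ε * (ε ^ 2 * H ε ^ 3) / 40 := by ring
    rw [this]; nlinarith
  refine
    { one_lt_l := hl
      ε_pos := h1
      c₀_pos := by rw [ic₀]; exact hc₀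
      c₁_pos := by rw [ic₁]; linarith
      c₁_le := by rw [ic₁]; exact h6.le
      η_lt := by rw [iη]; exact hηε
      ε_le := h2.le
      lε_le := hlε.le
      A_le_gppε := by rw [iA, igpp]; exact h7.le
      c₀_le := by rw [ic₀, hc₀']; nlinarith
      m₁_pos := by rw [im₁]; exact h8
      one_lt_m₁A := by rw [im₁, iA]; exact h9
      junction_ε₁ := by
        rw [im₁, igpp, igp]
        have : l / g ε ^ 3 + (l * ε / g ε) ^ 3 / ε = l / g ε ^ 3 + ε ^ 2 * (l / g ε) ^ 3 := by
          field_simp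
        rw [this]; exact h10
      junction_ε₂ := by
        rw [im₁, igp]
        have : m₁f ε * (l * ε / g ε) / ε = m₁f ε * (l / g ε) := by field_simp
        rw [this]; exact h11
      Aη_le := by
        rw [iA, iη, ic₁, hη']
        -- `A c₀³/40 ≤ c₀/2 ≤ c₁/2` as `A ε² H² < 20`
        have h13 : (1 + l) / 2 * (c₀f ε ^ 3 / 40) ≤ c₀f ε / 2 := by
          rw [hc₀']
          have : (1 + l) / 2 * ((ε * H ε) ^ 3 / 40) = (ε * H ε) * ((1 + l) / 2 * (ε ^ 2 * H ε ^ 2)) / 40 := by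
            ring
          rw [this]
          have hεH : 0 < ε * H ε := mul_pos h1 h3
          nlinarith
        linarith }

end SmallEps

end HParam

end Literature.Geometry.Symplectic

end
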